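import Literature.AlgebraicGeometry.Motives.HodgeStructurePontryaginHomologyExteriorAlgebra
import HarnessLib

/-!
# The Pontryagin product with a 1-cycle is the transpose of the interior product: `λ_ℓ ⋆ Ψ = Ψ ∘ i(ℓ)` on `H_•(X) = (⋀W)^∨`,
# the Laplace expansion `i(ℓ)(v_0 ∧ ⋯ ∧ v_n) = Σ (−1)^i ℓ(v_i) v_0 ∧ ⋯ v̂_i ⋯ ∧ v_n`, Bourbaki's `Φ(ℓ ∧ a) = Φ(a) ∘ i(ℓ)`
# (Pontryagin's isomorphism turns left multiplication by `ℓ ∈ H_1` into the transpose of `i(ℓ)`), and the transpose of the dual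
# Lefschetz operator: `Ψ ∘ Λ_ω = Φ(ω^∨) ⋆ Ψ` (Pontryagin product with the 2-cycle `Φ(Σ eᵢ* ∧ fᵢ*)`)

[topic AlgebraicGeometry/Motives]

Layer `Literature/AlgebraicGeometry/Motives`, lane `lit-hodgefound` (Track 2 foundations library; prover seat `lit-hodgefound-p34`,
generation 36, row g36-#7). THEOREMS ONLY (no definition, no named fact, no instance, no notation; net debt `0`). Sequel of rows
g29-#1 (`HodgeStructureExteriorPowerLefschetz`: the interior products `ann K W ℓ = i(ℓ)` — Mathlib's `CliffordAlgebra.contractLeft` — with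
the CAR rule `i(ℓ)(v ∧ x) = ℓ(v) x − v ∧ i(ℓ) x`, and `Λ = Σᵢ i(fᵢ*) i(eᵢ*)`), g35-#5 (`HodgeStructurePontryaginHomologyBasis`: the homological
Pontryagin ring `((⋀W)^∨, ⋆ = dualConv)`, the 1-cycles `λ_ℓ = dualOne ℓ`, LANGE'S FOURTH EQUATION `map_id_proj_one_comul_ιMulti` and the
induction step `dualConv_dualOne_ιMulti` of Lemma 2.5.12) and g36-#3 (`HodgeStructurePontryaginHomologyExteriorAlgebra`: Pontryagin's
theorem `Φ = pontryaginMap : ⋀(W^∨) ⥲ (⋀W)^∨`, `Φ(a ∧ b) = Φ(a) ⋆ Φ(b)`, graded commutativity).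

THE POINT. Lange's fourth equation says that the `(•, 1)`-Künneth component of `μ^*(v_0 ∧ ⋯ ∧ v_n)` is the Laplace row
`Σ_i (−1)^{i+n} (v_0 ∧ ⋯ v̂_i ⋯ ∧ v_n) ⊗ v_i`; the interior product `i(ℓ)` (an antiderivation) has the Laplace expansion
`i(ℓ)(v_0 ∧ ⋯ ∧ v_n) = Σ_i (−1)^i ℓ(v_i) v_0 ∧ ⋯ v̂_i ⋯ ∧ v_n` (§1). Comparing the two: Pontryagin multiplication by the 1-cycle `λ_ℓ`
on homology is, up to the sign `(−1)^n` on `H^{n+1}` for right multiplication and WITHOUT SIGN for left multiplication, the transpose of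
`i(ℓ)` on cohomology (§2) — the cap product with a 1-cycle. Through Pontryagin's isomorphism this is Bourbaki's description of the
interior product as the transpose of exterior multiplication: `Φ(ℓ ∧ a) = Φ(a) ∘ i(ℓ)` (§3), whence `Φ(ℓ_0 ∧ ⋯ ∧ ℓ_m)(z) =
Φ(ℓ_1 ∧ ⋯ ∧ ℓ_m)(i(ℓ_0) z)` — the determinant `det(ℓ_j(v_i))` of Lemma 2.5.12 computed by iterated contractions. (First brick of the
identity `Λ_θ = (· ⋆ θ^{g−1}/(g−1)!)` — Pontryagin product with `θ^{[g−1]}` is the dual Lefschetz operator — recorded as a free pointer.)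

## Sources, VERBATIM

N. Bourbaki, *Algebra I, Chapters 1–3* [BourbakiAlgebraI1989], Ch. III §11 no. 9 ("Interior products"; for the exterior algebra: the left
interior product `i(x)` by `x ∈ ⋀(M*)` on `⋀(M)` is the transpose of left multiplication by `x` on `⋀(M*)` for the canonical pairing of
§11 no. 5, and for `x* ∈ M*`, `i(x*)` is the antiderivation of degree `−1` with `i(x*)(y) = ⟨x*, y⟩` on `M`), no. 5 (the pairing
`⟨x₁* ∧ ⋯ ∧ x_p*, x₁ ∧ ⋯ ∧ x_p⟩ = det(⟨x_i*, x_j⟩)`); Ch. III §10 no. 2 Ex. 4 (antiderivations).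
H. Lange, *Abelian Varieties over the Complex Numbers* (2023) [Lange2023AbelianVarietiesComplex], §2.5.3 proof of Lemma 2.5.12 (p0133):
"`∫_{λ_I} dx_J = ∫_{μ(λ_{I_p} × λ_{i_{p+1}})} dx_J = ∫_{λ_{I_p} × λ_{i_{p+1}}} μ^* dx_J`" with "`μ^* dx_J = ∧_ν (p₁^*dx_{j_ν} + p₂^*dx_{j_ν}) =
Σ_ν (−1)^{p+1−ν} p₁^*dx_{J−j_ν} ∧ p₂^*dx_{j_ν} + ⋯`" — the Pontryagin product with the 1-cycle `λ_{i_{p+1}}` expands a form along its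
last index; §1.1 Exercise 1.1.6 (11) (p0027–p0028, the Pontryagin product `⋆ = μ_* ∘ ×`).
D. Grinberg, *The Clifford algebra and the Chevalley map* (2016) [cited through Mathlib `CliffordAlgebra.contractLeft_ι_mul`, "Theorem 6"].

## What is proved (all `theorem`s)

* §1 **`ann_ιMulti_succ` — THE LAPLACE EXPANSION OF THE INTERIOR PRODUCT: `i(ℓ)(v_0 ∧ ⋯ ∧ v_n) = Σ_i (−1)^i ℓ(v_i) · v_0 ∧ ⋯ v̂_i ⋯ ∧ v_n`**
  (induction on `n` from the CAR rule, the bookkeeping `ιMulti_comp_succ_succAbove` of row g35-#5).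
* §2 **`dualConv_dualOne_apply_ιMulti` / `dualConv_dualOne_apply_of_mem`: `(Ψ ⋆ λ_ℓ)(z) = (−1)^n Ψ(i(ℓ) z)` for `z ∈ H^{n+1}`**
  (Lange's fourth equation against §1), **`dualConv_dualOne_pontryaginMap`: `λ_ℓ ⋆ Φ(a) = Φ(a) ∘ i(ℓ)` for every `a ∈ ⋀(W^∨)`** (left
  multiplication: the sign is absorbed by graded commutativity, row g36-#3), and for `W` finite-dimensional **`dualConv_dualOne_eq`:
  `λ_ℓ ⋆ Ψ = Ψ ∘ i(ℓ)` for EVERY `Ψ ∈ H_•(X)`** — Pontryagin multiplication by a 1-cycle is the transpose of the interior product.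
* §3 BOURBAKI III §11 no. 9 THROUGH PONTRYAGIN'S ISOMORPHISM: **`pontryaginMap_ι_mul`: `Φ(ℓ ∧ a) = Φ(a) ∘ i(ℓ)`**,
  `pontryaginMap_ιMulti_succ_apply` (`Φ(ℓ_0 ∧ ℓ_1 ∧ ⋯ ∧ ℓ_n)(z) = Φ(ℓ_1 ∧ ⋯ ∧ ℓ_n)(i(ℓ_0) z)`: the determinant of Lemma 2.5.12 by
  iterated contractions), `dualOne_apply_eq_algebraMapInv_ann` (`λ_ℓ(z) = ε(i(ℓ) z)`).
* §4 `comp_ann_mul_ann_eq_dualConv` (`Ψ ∘ i(φ)i(ψ) = Φ(ψ ∧ φ) ⋆ Ψ`) and **`IsSymplectic.comp_lefschetzDual_eq_dualConv`: `Ψ ∘ Λ_ω =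
  Φ(ω^∨) ⋆ Ψ` — THE TRANSPOSE OF THE DUAL LEFSCHETZ OPERATOR `Λ = Σᵢ i(fᵢ*) i(eᵢ*)` IS THE PONTRYAGIN PRODUCT WITH THE 2-CYCLE `Φ(ω^∨)`,
  `ω^∨ = Σᵢ eᵢ* ∧ fᵢ*`** (homological form of "`Λ_θ = ⋆ θ^{[g−1]}`").

Not here: the cohomological readings through Poincaré duality `θ : x ↦ τ(x ∧ ·)` — `x ⋆ c = ± i(ℓ_c) x` for `c ∈ H^{2g−1}` (needs the
antiderivation rule for `i(ℓ)` on products and its adjunction under `τ`) and `Λ_θ x = x ⋆ θ^{[g−1]}` (needs `θ(θ^{[g−1]}) = Φ(ω^∨)`). TWIN NOTICE (RULING 29 bis): nothing of the torus-forms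
carriers or of `Motives/AbelianVarietyHopf` is imported or restated.

## References

* [BourbakiAlgebraI1989] N. Bourbaki, *Algebra I, Chapters 1–3* (1989), Ch. III §7 no. 1, §10 no. 2 Ex. 4, §11 no. 5, no. 9.
* [Lange2023AbelianVarietiesComplex] H. Lange, *Abelian Varieties over the Complex Numbers* (2023), §1.1 Exercise 1.1.6 (11), (12)
  (p0027–p0028); §2.5.3 Lemma 2.5.12 and its proof (p0133).
* [MumfordAV1970] D. Mumford, *Abelian Varieties* (1970), §1 (the Pontryagin product on `H_*`, `H_*(X) ≅ ⋀H_1(X)`).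
* [Voisin2002] C. Voisin, *Hodge Theory and Complex Algebraic Geometry I* (2002), §6.2.1 Lemma 6.19 (`Λ` in a symplectic basis).
-/

noncomputable section

open scoped TensorProduct

namespace Literature.AlgebraicGeometry.Motives

namespace ExteriorLefschetz

open ExteriorAlgebra

variable {K : Type*} [Field K] {W : Type*} [AddCommGroup W] [Module K W]

/-! ## §1 The Laplace expansion of the interior product -/

/-- **`i(ℓ)(v_0 ∧ ⋯ ∧ v_n) = Σ_i (−1)^i ℓ(v_i) · v_0 ∧ ⋯ v̂_i ⋯ ∧ v_n`** — the interior product by `ℓ ∈ W^∨` is the antiderivation of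
degree `−1` extending `ℓ`; induction on `n` from the CAR rule `i(ℓ)(v ∧ x) = ℓ(v) x − v ∧ i(ℓ) x` (row g29-#1 `ann_apply_ι_mul`).
[cite: BourbakiAlgebraI1989, Ch. III §11 no. 9 and §10 no. 2 Ex. 4 (antiderivations)] -/
theorem ann_ιMulti_succ (ℓ : Module.Dual K W) {n : ℕ} (v : Fin (n + 1) → W) :
    ann K W ℓ (ιMulti K (n + 1) v) = ∑ i : Fin (n + 1), ((-1 : K) ^ (i : ℕ) * ℓ (v i)) • ιMulti K n (v ∘ i.succAbove) := by
  induction n with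
  | zero =>
    rw [ιMulti_succ_apply, ιMulti_zero_apply, ann_apply_ι_mul, ann_apply_one, mul_zero, sub_zero, Fin.sum_univ_one, ιMulti_zero_apply,
      Fin.val_zero, pow_zero, one_mul]
  | succ n ih =>
    rw [ιMulti_succ_apply, ann_apply_ι_mul, ih, sub_eq_add_neg, Finset.mul_sum, ← Finset.sum_neg_distrib]
    conv_rhs => rw [Fin.sum_univ_succ]
    congr 1
    · simp only [Fin.val_zero, pow_zero, one_mul, Fin.succAbove_zero]
      rfl
    · refine Finset.sum_congr rfl fun i _ ↦ ?_
      rw [ιMulti_comp_succ_succAbove, Fin.val_succ, pow_succ, mul_neg_one, neg_mul, neg_smul, mul_smul_comm]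
      rfl

/-! ## §2 `(Ψ ⋆ λ_ℓ)(z) = (−1)^n Ψ(i(ℓ) z)` on `H^{n+1}` and `λ_ℓ ⋆ Ψ = Ψ ∘ i(ℓ)` -/

/-- **`(Ψ ⋆ λ_ℓ)(v_0 ∧ ⋯ ∧ v_n) = (−1)^n Ψ(i(ℓ)(v_0 ∧ ⋯ ∧ v_n))`**: Lange's fourth equation (row g35-#5 `dualConv_dualOne_ιMulti`:
`(Ψ ⋆ λ_ℓ)(v_0 ∧ ⋯ ∧ v_n) = Σ_i (−1)^{i+n} Ψ(v_0 ∧ ⋯ v̂_i ⋯ ∧ v_n) ℓ(v_i)`) against the Laplace expansion of §1.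
[cite: Lange2023AbelianVarietiesComplex, §2.5.3 proof of Lemma 2.5.12 (p0133, fourth equation)] [cite: BourbakiAlgebraI1989, Ch. III §11 no. 9] -/
theorem dualConv_dualOne_apply_ιMulti (Ψ : Module.Dual K (ExteriorAlgebra K W)) (ℓ : Module.Dual K W) {n : ℕ} (v : Fin (n + 1) → W) :
    dualConv K W Ψ (dualOne K W ℓ) (ιMulti K (n + 1) v) = (-1 : K) ^ n * Ψ (ann K W ℓ (ιMulti K (n + 1) v)) := by
  rw [dualConv_dualOne_ιMulti, ann_ιMulti_succ, map_sum, Finset.mul_sum]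
  refine Finset.sum_congr rfl fun i _ ↦ ?_
  rw [map_smul, smul_eq_mul, pow_add]
  ring

/-- **`(Ψ ⋆ λ_ℓ)(z) = (−1)^n Ψ(i(ℓ) z)` for every `z ∈ H^{n+1}(X) = ⋀^{n+1}W`** (§2 on the generators `v_0 ∧ ⋯ ∧ v_n`, linearity).
[cite: Lange2023AbelianVarietiesComplex, §2.5.3 proof of Lemma 2.5.12 (p0133)] [cite: BourbakiAlgebraI1989, Ch. III §11 no. 9] -/
theorem dualConv_dualOne_apply_of_mem (Ψ : Module.Dual K (ExteriorAlgebra K W)) (ℓ : Module.Dual K W) {n : ℕ} {z : ExteriorAlgebra K W}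
    (hz : z ∈ ⋀[K]^(n + 1) W) : dualConv K W Ψ (dualOne K W ℓ) z = (-1 : K) ^ n * Ψ (ann K W ℓ z) := by
  rw [← ιMulti_span_fixedDegree] at hz
  refine Submodule.span_induction (fun y hy ↦ ?_) (by rw [map_zero, map_zero, map_zero, mul_zero])
    (fun a b _ _ ha hb ↦ by rw [map_add, map_add, map_add, ha, hb, mul_add]) (fun c a _ ha ↦ by rw [map_smul, map_smul, map_smul, ha, smul_eq_mul, smul_eq_mul, mul_left_comm]) hz
  obtain ⟨v, rfl⟩ := hy
  exact dualConv_dualOne_apply_ιMulti Ψ ℓ v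

/-- **`λ_ℓ ⋆ Φ(a) = Φ(a) ∘ i(ℓ)` for every `a ∈ ⋀(W^∨)`** — LEFT Pontryagin multiplication by the 1-cycle `λ_ℓ = Φ(ℓ)` is the transpose of
the interior product `i(ℓ)`, with no sign: for `a ∈ ⋀ᵖ(W^∨)`, `λ_ℓ ⋆ Φ(a) = (−1)^p Φ(a) ⋆ λ_ℓ` (graded commutativity, row g36-#3), and on
`H^{n+1}` the previous theorem contributes `(−1)^n` with `Φ(a) ∘ i(ℓ)` vanishing there unless `n = p` (`Φ(⋀ᵖ)` lives on `H^p`, `i(ℓ)`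
lowers degrees by one). [cite: BourbakiAlgebraI1989, Ch. III §11 no. 9 (i(x*) as a transpose)] [cite: Lange2023AbelianVarietiesComplex, §2.5.3 proof of Lemma 2.5.12 (p0133)] -/
theorem dualConv_dualOne_pontryaginMap (ℓ : Module.Dual K W) (a : ExteriorAlgebra K (Module.Dual K W)) :
    dualConv K W (dualOne K W ℓ) (pontryaginMap K W a) = pontryaginMap K W a ∘ₗ ann K W ℓ := by
  induction a using DirectSum.Decomposition.inductionOn (fun i : ℕ ↦ ⋀[K]^i (Module.Dual K W)) with
  | zero => rw [map_zero, map_zero, LinearMap.zero_comp]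
  | add a b ha hb => rw [map_add, map_add, ha, hb, LinearMap.add_comp]
  | @homogeneous p a =>
    refine LinearMap.ext fun z ↦ ?_
    rw [← pontryaginMap_ι, dualConv_pontryaginMap_comm_of_mem (Literature.LinearAlgebra.Alternating.ι_mem_exteriorPower_one K ℓ) a.2,
      one_mul, LinearMap.smul_apply, pontryaginMap_ι, LinearMap.comp_apply]
    induction z using DirectSum.Decomposition.inductionOn (fun i : ℕ ↦ ⋀[K]^i W) with
    | zero => rw [map_zero, map_zero, map_zero, smul_zero]
    | add z z' hz hz' => rw [map_add, map_add, map_add, smul_add, hz, hz']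
    | @homogeneous k z =>
      cases k with
      | zero =>
        have hz : (z : ExteriorAlgebra K W) ∈ LinearMap.range (ι K : W →ₗ[K] ExteriorAlgebra K W) ^ 0 := z.2
        rw [pow_zero] at hz
        obtain ⟨r, hr⟩ := Submodule.mem_one.mp hz
        rw [← hr, ann_apply_algebraMap, map_zero, Algebra.algebraMap_eq_smul_one, map_smul, dualConv_dualOne_one, smul_zero, smul_zero]
      | succ n =>
        rw [dualConv_dualOne_apply_of_mem _ _ z.2, smul_eq_mul]
        by_cases hn : n = p
        · subst hn
          rw [← mul_assoc, ← pow_add, ← two_mul, pow_mul, neg_one_sq, one_pow, one_mul]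
        · have hmem : ann K W ℓ (z : ExteriorAlgebra K W) ∈ ⋀[K]^n W := by
            simpa only [Nat.add_sub_cancel] using ann_apply_mem ℓ z.2
          rw [pontryaginMap_apply_eq_zero_of_mem_of_mem a.2 hmem hn, mul_zero, mul_zero]

/-- **`λ_ℓ ⋆ Ψ = Ψ ∘ i(ℓ)` FOR EVERY `Ψ ∈ H_•(X) = (⋀W)^∨`** (`W = H¹(X)` finite-dimensional, so that `Ψ = Φ(a)` by Pontryagin's theorem,
row g36-#3): THE PONTRYAGIN PRODUCT WITH A 1-CYCLE IS THE TRANSPOSE OF THE INTERIOR PRODUCT (the cap product `λ_ℓ ⌢ ·` read on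
cohomology through `i(ℓ)`). [cite: BourbakiAlgebraI1989, Ch. III §11 no. 9] [cite: Lange2023AbelianVarietiesComplex, §2.5.3 proof of Lemma 2.5.12 (p0133) and §1.1 Exercise 1.1.6 (11) (p0028)] -/
theorem dualConv_dualOne_eq [FiniteDimensional K W] (ℓ : Module.Dual K W) (Ψ : Module.Dual K (ExteriorAlgebra K W)) :
    dualConv K W (dualOne K W ℓ) Ψ = Ψ ∘ₗ ann K W ℓ := by
  obtain ⟨a, rfl⟩ := (pontryaginEquiv K W).surjective Ψ
  rw [pontryaginEquiv_apply, dualConv_dualOne_pontryaginMap]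

/-! ## §3 Bourbaki III §11 no. 9 through Pontryagin's isomorphism: `Φ(ℓ ∧ a) = Φ(a) ∘ i(ℓ)` -/

/-- **`Φ(ℓ ∧ a) = Φ(a) ∘ i(ℓ)`**: Pontryagin's isomorphism `Φ : ⋀(W^∨) ⥲ (⋀W)^∨` turns left exterior multiplication by `ℓ ∈ W^∨ = H_1`
into the transpose of the interior product `i(ℓ)` — Bourbaki's characterisation of `i(x*)` (`Φ(ℓ ∧ a) = Φ(ℓ) ⋆ Φ(a) = λ_ℓ ⋆ Φ(a)`, rows
g36-#3 `pontryaginMap_mul`, `pontryaginMap_ι`, and §2). [cite: BourbakiAlgebraI1989, Ch. III §11 no. 9] -/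
theorem pontryaginMap_ι_mul (ℓ : Module.Dual K W) (a : ExteriorAlgebra K (Module.Dual K W)) :
    pontryaginMap K W (ι K ℓ * a) = pontryaginMap K W a ∘ₗ ann K W ℓ := by
  rw [pontryaginMap_mul, pontryaginMap_ι, dualConv_dualOne_pontryaginMap]

/-- **`Φ(ℓ_0 ∧ ℓ_1 ∧ ⋯ ∧ ℓ_n)(z) = Φ(ℓ_1 ∧ ⋯ ∧ ℓ_n)(i(ℓ_0) z)`** — peeling the first factor: iterating, `Φ(ℓ_0 ∧ ⋯ ∧ ℓ_n)(z) =
ε(i(ℓ_n) ⋯ i(ℓ_1) i(ℓ_0) z)`, the determinant `det(ℓ_j(v_i))` of Lemma 2.5.12 (row g35-#5 `dualConvProd_ιMulti`) computed by iterated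
contractions. [cite: BourbakiAlgebraI1989, Ch. III §11 no. 5 and no. 9] [cite: Lange2023AbelianVarietiesComplex, §2.5.3 Lemma 2.5.12 (p0133)] -/
theorem pontryaginMap_ιMulti_succ_apply {n : ℕ} (ℓ : Fin (n + 1) → Module.Dual K W) (z : ExteriorAlgebra K W) :
    pontryaginMap K W (ιMulti K (n + 1) ℓ) z = pontryaginMap K W (ιMulti K n (Matrix.vecTail ℓ)) (ann K W (ℓ 0) z) := by
  rw [ιMulti_succ_apply, pontryaginMap_ι_mul, LinearMap.comp_apply]

/-- **`λ_ℓ(z) = ε(i(ℓ) z)`**: the 1-cycle `λ_ℓ` is the augmentation after contraction (`λ_ℓ = Φ(ℓ) = Φ(ℓ ∧ 1)`, `Φ(1) = ε`).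
[cite: BourbakiAlgebraI1989, Ch. III §11 no. 9 (i(x*)(y) = ⟨x*, y⟩ on M)] [cite: Lange2023AbelianVarietiesComplex, §2.5.3 (p0133, "∫_{λ_i} dx_j = δ_{ij}")] -/
theorem dualOne_apply_eq_algebraMapInv_ann (ℓ : Module.Dual K W) (z : ExteriorAlgebra K W) :
    dualOne K W ℓ z = algebraMapInv (ann K W ℓ z) := by
  rw [← pontryaginMap_ι, ← mul_one (ι K ℓ), pontryaginMap_ι_mul, LinearMap.comp_apply, pontryaginMap_one, AlgHom.toLinearMap_apply]

/-! ## §4 The transpose of the dual Lefschetz operator: `Ψ ∘ Λ = Φ(ω^∨) ⋆ Ψ` -/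

/-- **`Ψ ∘ i(φ) i(ψ) = Φ(ψ ∧ φ) ⋆ Ψ`**: precomposition with a product of two interior products is left Pontryagin multiplication by the
2-cycle `λ_ψ ⋆ λ_φ = Φ(ψ ∧ φ)` (§2 twice and the associativity of `⋆`, row g35-#5). [cite: BourbakiAlgebraI1989, Ch. III §11 no. 9]
[cite: Lange2023AbelianVarietiesComplex, §1.1 Exercise 1.1.6 (11)(b)(ii) (p0028, associativity)] -/
theorem comp_ann_mul_ann_eq_dualConv [FiniteDimensional K W] (φ ψ : Module.Dual K W) (Ψ : Module.Dual K (ExteriorAlgebra K W)) :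
    Ψ ∘ₗ (ann K W φ * ann K W ψ) = dualConv K W (pontryaginMap K W (ι K ψ * ι K φ)) Ψ := by
  rw [Module.End.mul_eq_comp, ← LinearMap.comp_assoc, pontryaginMap_mul, pontryaginMap_ι, pontryaginMap_ι, dualConv_assoc,
    dualConv_dualOne_eq, dualConv_dualOne_eq]

/-- **THE TRANSPOSE OF THE DUAL LEFSCHETZ OPERATOR IS PONTRYAGIN MULTIPLICATION BY THE DUAL SYMPLECTIC 2-CYCLE: `Ψ ∘ Λ_ω = Φ(ω^∨) ⋆ Ψ`**
for every `Ψ ∈ H_•(X) = (⋀W)^∨`, where `ω = Σᵢ eᵢ ∧ fᵢ` in a Darboux basis `b`, `Λ_ω = Σᵢ i(fᵢ*) i(eᵢ*)` (row g29-#1 `lefschetzDual_eq_lam`,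
Voisin's Lemma 6.19) and `ω^∨ = Σᵢ eᵢ* ∧ fᵢ* ∈ ⋀²(W^∨)` is the 2-vector of the dual Darboux basis (`twoVector b.dualBasis`): on homology,
`ᵗΛ` is the Pontryagin product with the 2-cycle `Φ(ω^∨) ∈ H_2` — the homological form of "`Λ_θ` is the Pontryagin product with the curve
class `θ^{g−1}/(g−1)!`" (the 2-cycle `Φ(ω^∨)` being Poincaré dual to `θ^{[g−1]}`; that identification is not made here).
[cite: Voisin2002, §6.2.1 Lemma 6.19 (Λ in a symplectic basis)] [cite: BourbakiAlgebraI1989, Ch. III §11 no. 9]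
[cite: Lange2023AbelianVarietiesComplex, §2.5.3 Lemma 2.5.12 (p0133) and §1.1 Exercise 1.1.6 (11) (p0028)] -/
theorem IsSymplectic.comp_lefschetzDual_eq_dualConv [CharZero K] {g : ℕ} {ω : ExteriorAlgebra K W} (hω : IsSymplectic ω g)
    (b : Module.Basis (Fin g ⊕ Fin g) K W) (hb : ω = twoVector b) (Ψ : Module.Dual K (ExteriorAlgebra K W)) :
    Ψ ∘ₗ lefschetzDual ω g = dualConv K W (pontryaginMap K W (twoVector b.dualBasis)) Ψ := by
  haveI : FiniteDimensional K W := hω.finite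
  refine LinearMap.ext fun z ↦ ?_
  simp only [hω.lefschetzDual_eq_lam b hb, lam, twoVector, LinearMap.comp_apply, LinearMap.sum_apply, map_sum Ψ,
    map_sum (pontryaginMap K W), map_sum (dualConv K W), Module.Basis.coe_dualBasis]
  refine Finset.sum_congr rfl fun i _ ↦ ?_
  rw [← comp_ann_mul_ann_eq_dualConv, LinearMap.comp_apply]

end ExteriorLefschetz

end Literature.AlgebraicGeometry.Motives
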